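import Summits.QuantumFields.YangMills.Theorems.FluctuationComparisonRegPrIntLS2BetaWhitneyHatLiftCurvature
import Summits.QuantumFields.YangMills.Theorems.FluctuationComparisonRegPrIntLS2BetaSU2FourFactorSecondOrder
import HarnessLib

/-!
# S2β · (L♭) road, way-out (a) «kinematic» — THE REFINED (F3) LETTER: THE CURVATURE OF THE HAT LIFT TO SECOND ORDER,
# `dist1 (V(∂p)) ≤ (L⁻¹)²·(F + (F + 12σ²)² + 20σΔ + 2Δ² + 35σ³)` — NO `σ²` TERM; `Δ` = the deviation of the coarse logs over the hat support from two reference vectors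

Cell `ym3-torus` (rung R3 = continuum `SU(2)` Yang–Mills on the three-torus — NOT d = 4, NOT infinite volume, NOT a mass gap, NOT Clay).
Width seat «width 21» `ym3-torus-px21` (gen 23), FREE px helper on crux `stmt-QuantumFields-20520` (`Theses.UnitScaleTilt.FluctuationComparisonRegPrIntL`);
`--kind proof --supports stmt-QuantumFields-20520 --as helper`, count-neutral, DEFINITION-FREE (0 `def`, 0 `instance`, 0 `notation`, 0 `sorry`, default heartbeats;
weights `w`, lift `V` and cube-column weights `W` pinned by px12 g23's formulas `hw`∕`hV`∕written-out `W`, exactly as in ✓`…S2BetaWhitneyHatLiftCurvature`).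
GO px16 g22 14:45:27Z («GO px21 on (a)-kinematic»), px12 g24 14:44:38Z («GO — not MINE»; pointer ✓`…WhitneyHatLiftCurvatureSq.dist1_rect_lift_sq_le`).

WHY (UV3-NODE §84∕§86.5; px12 g24 14:42:08Z RISK (3)–(4); px8 g24 ✓`…S2BetaSmallBondGaugeToronObstruction`).  The crude letter ✓`dist1_plaqHol_lift_le`
(`dist1 (V(∂p)) ≤ (L⁻¹)²(F + 12σ²) + 12(L⁻¹σ)²`) feeds the (L♭) sup-profile step ✓`arc_le_sup_step_hatLift` its quadratic coefficient `C₂ = (π∕2)·N_P·24·L⁻²`, whence the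
start threshold `M(L) ≈ 10⁻²` below the toron floor of small volumes.  The `σ²` is NOT intrinsic: to second order (✓`…SU2FourFactorSecondOrder`) a plaquette word is
`1 + ιℓ + ½(ιℓ)² + [ιa, ιd] + O(SIZE × PARALLEL VARIATION + SIZE³)` with `[ιa, ιd]` the commutator of the two DIRECTIONS at the base corner, and for the hat lift
(i) the fine linearised curl is `L⁻¹ ×` the column average of the coarse ones EXACTLY (✓`lincurl_hat_eq`), (ii) a SMALL coarse plaquette forces its linearised curl to be
`≈ −[ιB⟨y,μ⟩, ιB⟨y,ν⟩]` (✓`norm_lincurl_logVec_add_comm_le`), (iii) the fine commutator is the commutator of two hat AVERAGES of the coarse `μ`- and `ν`-logs — so the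
second-order terms CANCEL up to «commutator of averages − average of commutators», which is `≤ 8σΔ` with `Δ` the deviation of the coarse logs over the support from two
reference vectors `Rμ, Rν` (commutator Lipschitz ✓`norm_comm_sub_comm_le_add`; both weight families are convex).  Result: the refined letter of the title — every
junk term is `F`-class, `σΔ`, `Δ²` or `σ³`.  A priori `Δ ≤ 2σ` only (then no gain); the gain of way-out (a) materialises with a VARIATION profile carried next to the
sup profile (torons have `Δ = 0`) — the lane holder's (px16 g22) ∕ assembler's (px12 g24) design call, NOT made here.
* §1 `colW_swap` (the column weights are symmetric in the two plaquette directions), ★`norm_sum_colW_smul_le` (a column-convex combination is bounded on the support),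
  `norm_hatSum_sub_le_of_support` (a hat average is within `r` of a reference vector if its support is), ★`norm_sub_shift_hat_le` (ONE-direction fine variation
  `‖a⟨x,μ⟩ − a⟨x+e_ν,μ⟩‖ ≤ L⁻¹ · max_column ‖A⟨y,μ⟩ − A⟨y+e_ν,μ⟩‖`, from ✓`sub_shift_hat_eq`).
* §2 ★`norm_comm_sub_comm_ref_le` (`‖[ιa, ιd] − [ιR, ιR′]‖ ≤ 4sΔ′`), ★★`norm_imQuat_lincurl_add_comm_ref_le` (ONE COARSE PLAQUETTE: sizes `≤ σ ≤ 1∕4`, chord `≤ F`,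
  deviations∕parallel variations `≤ Δ`, `‖Rμ‖ ≤ σ` ⟹ `‖ι ℓ̄ + [ιRμ, ιRν]‖ ≤ F + ½(F + 12σ²)² + 10σΔ + Δ² + (35∕2)σ³`).
* §3 ★★★`dist1_plaqHol_lift_le_second` — THE REFINED (F3) LETTER, support-local hypotheses shaped like ✓`dist1_plaqHol_lift_le`'s (`hσb` sizes on the four fine bonds'
  supports; `hΔμ`∕`hΔν` reference deviations on the two base-corner supports; `hσy` on the cube column: four sizes, the chord `dist1 (X(∂P_y)) ≤ F`, two reference deviations,
  two parallel variations):  `dist1 (V(∂p)) ≤ (L⁻¹)²·(F + (F + 12σ²)² + 20σΔ + 2Δ² + 35σ³)`.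

HONEST SCOPE.  Finite sums, convexity and the `ℍ` algebra of the companion file; every constant explicit and crude; nothing of Bałaban's analysis is asserted or proved
([Balaban1985RegularSpaces] (1.29) p.81 — size AND derivative bounds of the small fields in the regular spaces — is the printed locus this kinematics serves; the hat lift is
px12 g23's construction after [Balaban1984PropagatorsI] (1.7) p.18); the `(s, v)` two-profile recursion, its thresholds, (L♭) along the towers, (H♭), (D♮), GAP♯∘, S2β, crux 20520
and `YM3TorusSU2` are NOT proved; no registered stub is closed; rung R3 = SU(2) YM₃ on T³ — NOT d = 4, NOT infinite volume, NOT a mass gap, NOT Clay; the Yang–Mills mass gap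
is NOT proved.  References: T. Bałaban, CMP **99** (1985) 75–102 [Balaban1985RegularSpaces]; CMP **102** (1985) 277–309 [Balaban1985Variational]; CMP **109** (1987) 249–301
[Balaban1987RG1].
-/

set_option autoImplicit false

namespace Summit.QuantumFields.YangMills.Theorems.FluctuationComparisonRegPrIntLS2BetaWhitneyHatLiftCurvatureSecondOrder

open Finset
open scoped Real Quaternion
open Literature.MathematicalPhysics.QuantumLattice (su2Quat)
open Literature.MathematicalPhysics.QuantumFieldTheory.Balaban1983to89
open B10Eq27TorusAxialLog (rel rel_apply)
open T4CubeChartGnomonic (SU2)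
open T4HaarSU2ExpChart (imQuat norm_imQuat expPoint)
open T4ExpWindowSmallField (logVec expPoint_logVec)
open Summit.QuantumFields.YangMills.Theorems.FluctuationComparisonRegPrIntLS2BetaWhitneyHatWeights (sum_hatW_eq_one hatW_nonneg)
open Summit.QuantumFields.YangMills.Theorems.FluctuationComparisonRegPrIntLS2BetaWhitneyHatCurl
  (lincurl_hat_eq sub_shift_hat_eq colW_nonneg sum_colW_eq_one norm_lincurl_hat_le)
open Summit.QuantumFields.YangMills.Theorems.FluctuationComparisonRegPrIntLS2BetaWhitneyHatLiftCurvature (norm_hatSum_le_of_support)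
open Summit.QuantumFields.YangMills.Theorems.FluctuationComparisonRegPrIntLS2BetaSU2FourFactorExpansion (norm_lincurl_le_dist1_add)
open Summit.QuantumFields.YangMills.Theorems.FluctuationComparisonRegPrIntLS2BetaSU2FourFactorSecondOrder
  (dist1_plaq4_le_comm norm_lincurl_logVec_add_comm_le norm_comm_sub_comm_le_add)

variable {P : Params} {t : ℕ}

/-! ## §1 Column and hat convex combinations -/

/-- The cube-column weight `W(x; μ, ν; y) = χ_μ · Π_{κ ≠ μ,ν} hat_κ · χ_ν` is symmetric in the two plaquette directions. [folklore] -/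
theorem colW_swap (x : Site P t) (μ ν : Fin P.d) (y : Site P (t + 1)) :
    (if (x ν - emb y ν).val < P.L then (1 : ℝ) else 0) *
        (∏ κ ∈ (Finset.univ.erase ν).erase μ, max 0 (1 - ((rel (emb y) x κ).natAbs : ℝ) / P.L)) *
        (if (x μ - emb y μ).val < P.L then (1 : ℝ) else 0)
      = (if (x μ - emb y μ).val < P.L then (1 : ℝ) else 0) *
        (∏ κ ∈ (Finset.univ.erase μ).erase ν, max 0 (1 - ((rel (emb y) x κ).natAbs : ℝ) / P.L)) *
        (if (x ν - emb y ν).val < P.L then (1 : ℝ) else 0) := by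
  rw [Finset.erase_right_comm]; ring

/-- ★ **A COLUMN-CONVEX COMBINATION IS BOUNDED ON THE SUPPORT**: `‖Σ_y W(x;μ,ν;y) • Z y‖ ≤ M` whenever `‖Z y‖ ≤ M` at every `y` with `W ≠ 0` (`W ≥ 0`, `Σ W = 1`;
any real normed space). [folklore] -/
theorem norm_sum_colW_smul_le {E : Type*} [NormedAddCommGroup E] [NormedSpace ℝ E] (ht : t + 1 ≤ P.m + P.K) (x : Site P t)
    {μ ν : Fin P.d} (hμν : μ ≠ ν) (Z : Site P (t + 1) → E) {M : ℝ}
    (hM : ∀ y : Site P (t + 1), (if (x μ - emb y μ).val < P.L then (1 : ℝ) else 0) *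
          (∏ κ ∈ (Finset.univ.erase μ).erase ν, max 0 (1 - ((rel (emb y) x κ).natAbs : ℝ) / P.L)) *
          (if (x ν - emb y ν).val < P.L then (1 : ℝ) else 0) ≠ 0 → ‖Z y‖ ≤ M) :
    ‖∑ y : Site P (t + 1), ((if (x μ - emb y μ).val < P.L then (1 : ℝ) else 0) *
          (∏ κ ∈ (Finset.univ.erase μ).erase ν, max 0 (1 - ((rel (emb y) x κ).natAbs : ℝ) / P.L)) *
          (if (x ν - emb y ν).val < P.L then (1 : ℝ) else 0)) • Z y‖ ≤ M := by
  refine (norm_sum_le _ _).trans ?_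
  have hsum := sum_colW_eq_one ht x hμν
  calc ∑ y : Site P (t + 1), ‖((if (x μ - emb y μ).val < P.L then (1 : ℝ) else 0) *
          (∏ κ ∈ (Finset.univ.erase μ).erase ν, max 0 (1 - ((rel (emb y) x κ).natAbs : ℝ) / P.L)) *
          (if (x ν - emb y ν).val < P.L then (1 : ℝ) else 0)) • Z y‖
      ≤ ∑ y : Site P (t + 1), (if (x μ - emb y μ).val < P.L then (1 : ℝ) else 0) *
          (∏ κ ∈ (Finset.univ.erase μ).erase ν, max 0 (1 - ((rel (emb y) x κ).natAbs : ℝ) / P.L)) *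
          (if (x ν - emb y ν).val < P.L then (1 : ℝ) else 0) * M := by
        refine Finset.sum_le_sum fun y _ => ?_
        rw [norm_smul, Real.norm_eq_abs, abs_of_nonneg (colW_nonneg x μ ν y)]
        by_cases h0 : (if (x μ - emb y μ).val < P.L then (1 : ℝ) else 0) *
            (∏ κ ∈ (Finset.univ.erase μ).erase ν, max 0 (1 - ((rel (emb y) x κ).natAbs : ℝ) / P.L)) *
            (if (x ν - emb y ν).val < P.L then (1 : ℝ) else 0) = 0
        · rw [h0, zero_mul, zero_mul]
        · exact mul_le_mul_of_nonneg_left (hM y h0) (colW_nonneg x μ ν y)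
    _ = M := by rw [← Finset.sum_mul, hsum, one_mul]

/-- **A HAT AVERAGE IS WITHIN `r` OF A REFERENCE VECTOR IF ITS SUPPORT IS**: `‖Σ_e w b e • A e − R‖ ≤ r` whenever `‖A e − R‖ ≤ r` at every `e` with `w b e ≠ 0`
(`Σ_e w b e = 1`, ✓`norm_hatSum_le_of_support`). [folklore] -/
theorem norm_hatSum_sub_le_of_support (ht : t + 1 ≤ P.m + P.K) (w : PBond P t → PBond P (t + 1) → ℝ)
    (hw : ∀ b e, w b e = if e.dir = b.dir ∧ (b.src b.dir - emb e.src b.dir).val < P.L then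
      ∏ ν ∈ Finset.univ.erase b.dir, max 0 (1 - ((rel (emb e.src) b.src ν).natAbs : ℝ) / P.L) else 0)
    (A : PBond P (t + 1) → EuclideanSpace ℝ (Fin 3)) (b : PBond P t) (R : EuclideanSpace ℝ (Fin 3)) {r : ℝ}
    (hr : ∀ e, w b e ≠ 0 → ‖A e - R‖ ≤ r) : ‖∑ e, w b e • A e - R‖ ≤ r := by
  have e1 : ∑ e, w b e • A e - R = ∑ e, w b e • (A e - R) := by
    rw [show R = ∑ e, w b e • R by rw [← Finset.sum_smul, sum_hatW_eq_one ht w hw b, one_smul], ← Finset.sum_sub_distrib]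
    refine Finset.sum_congr rfl fun e _ => ?_
    rw [smul_sub, ← Finset.sum_smul, sum_hatW_eq_one ht w hw b, one_smul]
  rw [e1]
  exact norm_hatSum_le_of_support ht w hw (fun e => A e - R) b hr

/-- ★ **ONE-DIRECTION FINE VARIATION**: `‖a⟨x, μ⟩ − a⟨x + e_ν, μ⟩‖ ≤ L⁻¹ · M` whenever `‖A⟨y, μ⟩ − A⟨y + e_ν, μ⟩‖ ≤ M` on the cube column through `(x; μ, ν)`
(✓`sub_shift_hat_eq` + `norm_sum_colW_smul_le`). [folklore] -/
theorem norm_sub_shift_hat_le (ht : t + 1 ≤ P.m + P.K) (w : PBond P t → PBond P (t + 1) → ℝ)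
    (hw : ∀ b e, w b e = if e.dir = b.dir ∧ (b.src b.dir - emb e.src b.dir).val < P.L then
      ∏ ν ∈ Finset.univ.erase b.dir, max 0 (1 - ((rel (emb e.src) b.src ν).natAbs : ℝ) / P.L) else 0)
    (A : PBond P (t + 1) → EuclideanSpace ℝ (Fin 3)) (a : PBond P t → EuclideanSpace ℝ (Fin 3)) (ha : ∀ b, a b = ∑ e, w b e • A e)
    (x : Site P t) {μ ν : Fin P.d} (hνμ : ν ≠ μ) {M : ℝ}
    (hM : ∀ y : Site P (t + 1), (if (x μ - emb y μ).val < P.L then (1 : ℝ) else 0) *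
          (∏ κ ∈ (Finset.univ.erase μ).erase ν, max 0 (1 - ((rel (emb y) x κ).natAbs : ℝ) / P.L)) *
          (if (x ν - emb y ν).val < P.L then (1 : ℝ) else 0) ≠ 0 → ‖A ⟨y, μ⟩ - A ⟨y.shift ν, μ⟩‖ ≤ M) :
    ‖a ⟨x, μ⟩ - a ⟨x.shift ν, μ⟩‖ ≤ (P.L : ℝ)⁻¹ * M := by
  have hLinv0 : 0 ≤ (P.L : ℝ)⁻¹ := inv_nonneg.mpr (Nat.cast_nonneg _)
  rw [sub_shift_hat_eq ht w hw A a ha x hνμ, norm_smul, Real.norm_eq_abs, abs_of_nonneg hLinv0]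
  exact mul_le_mul_of_nonneg_left (norm_sum_colW_smul_le ht x hνμ.symm (fun y => A ⟨y, μ⟩ - A ⟨y.shift ν, μ⟩) hM) hLinv0

/-! ## §2 The two second-order matching letters -/

/-- ★ **THE FINE COMMUTATOR VS A REFERENCE COMMUTATOR**: `‖[ιa, ιd] − [ιR, ιR′]‖ ≤ 4 s Δ′` when `‖a − R‖, ‖d − R′‖ ≤ Δ′` and `‖d‖, ‖R‖ ≤ s`
(commutator Lipschitz ✓`norm_comm_sub_comm_le_add`). [folklore] -/
theorem norm_comm_sub_comm_ref_le (a d R R' : EuclideanSpace ℝ (Fin 3)) {s Δ' : ℝ} (haR : ‖a - R‖ ≤ Δ') (hdR : ‖d - R'‖ ≤ Δ')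
    (hd : ‖d‖ ≤ s) (hR : ‖R‖ ≤ s) :
    ‖(imQuat a * imQuat d - imQuat d * imQuat a) - (imQuat R * imQuat R' - imQuat R' * imQuat R)‖ ≤ 4 * s * Δ' := by
  have h := norm_comm_sub_comm_le_add (imQuat a) (imQuat d) (imQuat R) (imQuat R')
  rw [← map_sub, ← map_sub, norm_imQuat, norm_imQuat, norm_imQuat, norm_imQuat] at h
  have hΔ0 : 0 ≤ Δ' := (norm_nonneg _).trans haR
  have hs0 : 0 ≤ s := (norm_nonneg _).trans hd
  have h1 : 2 * ‖a - R‖ * ‖d‖ ≤ 2 * Δ' * s := by gcongr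
  have h2 : 2 * ‖R‖ * ‖d - R'‖ ≤ 2 * s * Δ' := by gcongr
  linarith

/-- ★★ **ONE COARSE PLAQUETTE: ITS LINEARISED CURL CANCELS A REFERENCE COMMUTATOR** — for `X₁, …, X₄ ∈ SU(2)` (the plaquette word `X₁X₂X₃⁻¹X₄⁻¹`, `B_i = log X_i`) with
arcs `≤ σ ≤ 1∕4`, chord `dist1 ≤ F`, reference deviations `‖B₁ − Rμ‖, ‖B₄ − Rν‖ ≤ Δ`, parallel variations `‖B₃ − B₁‖, ‖B₂ − B₄‖ ≤ Δ` and `‖Rμ‖ ≤ σ`: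
`‖ι(B₁ + B₂ − B₃ − B₄) + [ιRμ, ιRν]‖ ≤ F + ½(F + 12σ²)² + 10σΔ + Δ² + (35∕2)σ³`
(✓`norm_lincurl_logVec_add_comm_le` + ✓`norm_lincurl_le_dist1_add` + `norm_comm_sub_comm_ref_le`). [cite: Balaban1985Variational, (34) p.283] -/
theorem norm_imQuat_lincurl_add_comm_ref_le (X₁ X₂ X₃ X₄ : SU2) (Rμ Rν : EuclideanSpace ℝ (Fin 3)) {σ F Δ : ℝ}
    (h₁ : ‖logVec (su2Quat X₁)‖ ≤ σ) (h₂ : ‖logVec (su2Quat X₂)‖ ≤ σ) (h₃ : ‖logVec (su2Quat X₃)‖ ≤ σ) (h₄ : ‖logVec (su2Quat X₄)‖ ≤ σ)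
    (hσ4 : σ ≤ 1 / 4) (hRμ : ‖Rμ‖ ≤ σ) (hF : dist1 (X₁ * X₂ * X₃⁻¹ * X₄⁻¹) ≤ F)
    (hd₁ : ‖logVec (su2Quat X₁) - Rμ‖ ≤ Δ) (hd₄ : ‖logVec (su2Quat X₄) - Rν‖ ≤ Δ)
    (hv₃ : ‖logVec (su2Quat X₃) - logVec (su2Quat X₁)‖ ≤ Δ) (hv₂ : ‖logVec (su2Quat X₂) - logVec (su2Quat X₄)‖ ≤ Δ) :
    ‖imQuat (logVec (su2Quat X₁) + logVec (su2Quat X₂) - logVec (su2Quat X₃) - logVec (su2Quat X₄))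
        + (imQuat Rμ * imQuat Rν - imQuat Rν * imQuat Rμ)‖
      ≤ F + (F + 12 * σ ^ 2) ^ 2 / 2 + 10 * σ * Δ + Δ ^ 2 + 35 / 2 * σ ^ 3 := by
  have hσ0 : 0 ≤ σ := (norm_nonneg _).trans h₁
  have hΔ0 : 0 ≤ Δ := (norm_nonneg _).trans hd₁
  have hF0 : 0 ≤ F := (GaugeGroup.dist1_nonneg _).trans hF
  -- the second-order letter of the companion file
  have hA := norm_lincurl_logVec_add_comm_le X₁ X₂ X₃ X₄ h₁ h₂ h₃ h₄ hσ4
  -- the linearised curl is chord + 12σ² (first-order letter)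
  have hℓ : ‖logVec (su2Quat X₁) + logVec (su2Quat X₂) - logVec (su2Quat X₃) - logVec (su2Quat X₄)‖ ≤ F + 12 * σ ^ 2 := by
    have h := norm_lincurl_le_dist1_add h₁ h₂ h₃ h₄ hσ4
    rw [expPoint_logVec, expPoint_logVec, expPoint_logVec, expPoint_logVec] at h
    linarith
  have hℓ2 : ‖logVec (su2Quat X₁) + logVec (su2Quat X₂) - logVec (su2Quat X₃) - logVec (su2Quat X₄)‖ ^ 2 / 2 ≤ (F + 12 * σ ^ 2) ^ 2 / 2 :=
    div_le_div_of_nonneg_right (pow_le_pow_left₀ (norm_nonneg _) hℓ 2) (by norm_num)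
  -- the base commutator vs the reference commutator
  have hC := norm_comm_sub_comm_ref_le (logVec (su2Quat X₁)) (logVec (su2Quat X₄)) Rμ Rν hd₁ hd₄ h₄ hRμ
  have hvv : ‖logVec (su2Quat X₃) - logVec (su2Quat X₁)‖ * ‖logVec (su2Quat X₂) - logVec (su2Quat X₄)‖ ≤ Δ * Δ :=
    mul_le_mul hv₃ hv₂ (norm_nonneg _) hΔ0
  have hv' : 3 * σ * (‖logVec (su2Quat X₃) - logVec (su2Quat X₁)‖ + ‖logVec (su2Quat X₂) - logVec (su2Quat X₄)‖) ≤ 3 * σ * (Δ + Δ) :=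
    mul_le_mul_of_nonneg_left (add_le_add hv₃ hv₂) (by positivity)
  calc ‖imQuat (logVec (su2Quat X₁) + logVec (su2Quat X₂) - logVec (su2Quat X₃) - logVec (su2Quat X₄))
          + (imQuat Rμ * imQuat Rν - imQuat Rν * imQuat Rμ)‖
      = ‖(imQuat (logVec (su2Quat X₁) + logVec (su2Quat X₂) - logVec (su2Quat X₃) - logVec (su2Quat X₄))
          + (imQuat (logVec (su2Quat X₁)) * imQuat (logVec (su2Quat X₄)) - imQuat (logVec (su2Quat X₄)) * imQuat (logVec (su2Quat X₁))))
          - ((imQuat (logVec (su2Quat X₁)) * imQuat (logVec (su2Quat X₄)) - imQuat (logVec (su2Quat X₄)) * imQuat (logVec (su2Quat X₁)))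
            - (imQuat Rμ * imQuat Rν - imQuat Rν * imQuat Rμ))‖ := by congr 1; abel
    _ ≤ _ := norm_sub_le _ _
    _ ≤ F + (F + 12 * σ ^ 2) ^ 2 / 2 + 10 * σ * Δ + Δ ^ 2 + 35 / 2 * σ ^ 3 := by nlinarith [hA, hC, hℓ2, hvv, hv', hF]

/-! ## §3 The refined (F3) letter -/

/-- ★★★ **THE CURVATURE OF THE HAT LIFT TO SECOND ORDER (refined (F3), local form)**.  Standing range; `X` the coarse field, `V` its hat lift (px12's `hw`∕`hV`), `p = (x; μ < ν)`
a fine plaquette.  Hypotheses: `σ ≤ 1∕4` bounds the arcs of the coarse bonds feeding the four bonds of `p` (`hσb`) and the edges of the column plaquettes (`hσy`); two reference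
vectors `Rμ, Rν` (`‖Rμ‖ ≤ σ`) are within `Δ` of the coarse `μ`-logs feeding `a⟨x,μ⟩` (`hΔμ`), of the `ν`-logs feeding `a⟨x,ν⟩` (`hΔν`), and of the base-corner logs of every
column plaquette, whose two PARALLEL variations are also `≤ Δ` and whose chord is `≤ F` (`hσy`).  Then
    `dist1 (V(∂p)) ≤ (L⁻¹)² · (F + (F + 12σ²)² + 20σΔ + 2Δ² + 35σ³)`
— the `L⁻²` gain on the flux with NO `SIZE²` term: the fine commutator `[ιa⟨x,μ⟩, ιa⟨x,ν⟩]` is matched by the column average of the coarse commutators, which the small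
coarse plaquettes force to cancel the coarse linearised curls (§2), up to `σΔ`, `Δ²`, `σ³`. [cite: Balaban1985RegularSpaces, (1.29) p.81] -/
theorem dist1_plaqHol_lift_le_second (ht : t + 1 ≤ P.m + P.K) (w : PBond P t → PBond P (t + 1) → ℝ)
    (hw : ∀ b e, w b e = if e.dir = b.dir ∧ (b.src b.dir - emb e.src b.dir).val < P.L then
      ∏ ν ∈ Finset.univ.erase b.dir, max 0 (1 - ((rel (emb e.src) b.src ν).natAbs : ℝ) / P.L) else 0)
    (X : GaugeField P (t + 1) SU2) (V : GaugeField P t SU2)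
    (hV : ∀ b, V b = expPoint (∑ e, w b e • ((P.L : ℝ)⁻¹ • logVec (su2Quat (X e))))) (p : Plaq P t)
    {σ F Δ : ℝ} (Rμ Rν : EuclideanSpace ℝ (Fin 3)) (hσ4 : σ ≤ 1 / 4) (hRμ : ‖Rμ‖ ≤ σ)
    (hσb : ∀ e, (w ⟨p.src, p.μ⟩ e ≠ 0 ∨ w ⟨p.src.shift p.μ, p.ν⟩ e ≠ 0 ∨ w ⟨p.src.shift p.ν, p.μ⟩ e ≠ 0 ∨ w ⟨p.src, p.ν⟩ e ≠ 0) →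
      ‖logVec (su2Quat (X e))‖ ≤ σ)
    (hΔμ : ∀ e, w ⟨p.src, p.μ⟩ e ≠ 0 → ‖logVec (su2Quat (X e)) - Rμ‖ ≤ Δ)
    (hΔν : ∀ e, w ⟨p.src, p.ν⟩ e ≠ 0 → ‖logVec (su2Quat (X e)) - Rν‖ ≤ Δ)
    (hσy : ∀ y : Site P (t + 1), (if (p.src p.μ - emb y p.μ).val < P.L then (1 : ℝ) else 0) *
          (∏ κ ∈ (Finset.univ.erase p.μ).erase p.ν, max 0 (1 - ((rel (emb y) p.src κ).natAbs : ℝ) / P.L)) *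
          (if (p.src p.ν - emb y p.ν).val < P.L then (1 : ℝ) else 0) ≠ 0 →
      ‖logVec (su2Quat (X ⟨y, p.μ⟩))‖ ≤ σ ∧ ‖logVec (su2Quat (X ⟨y.shift p.μ, p.ν⟩))‖ ≤ σ ∧
        ‖logVec (su2Quat (X ⟨y.shift p.ν, p.μ⟩))‖ ≤ σ ∧ ‖logVec (su2Quat (X ⟨y, p.ν⟩))‖ ≤ σ ∧
        dist1 (GaugeField.plaqHol X ⟨y, p.μ, p.ν, p.hμν⟩) ≤ F ∧
        ‖logVec (su2Quat (X ⟨y, p.μ⟩)) - Rμ‖ ≤ Δ ∧ ‖logVec (su2Quat (X ⟨y, p.ν⟩)) - Rν‖ ≤ Δ ∧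
        ‖logVec (su2Quat (X ⟨y.shift p.ν, p.μ⟩)) - logVec (su2Quat (X ⟨y, p.μ⟩))‖ ≤ Δ ∧
        ‖logVec (su2Quat (X ⟨y.shift p.μ, p.ν⟩)) - logVec (su2Quat (X ⟨y, p.ν⟩))‖ ≤ Δ) :
    dist1 (GaugeField.plaqHol V p) ≤ ((P.L : ℝ)⁻¹) ^ 2 * (F + (F + 12 * σ ^ 2) ^ 2 + 20 * σ * Δ + 2 * Δ ^ 2 + 35 * σ ^ 3) := by
  have hL1 : (1 : ℝ) ≤ P.L := by exact_mod_cast P.L_pos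
  set u : ℝ := (P.L : ℝ)⁻¹ with hu
  have hu1 : u ≤ 1 := inv_le_one_of_one_le₀ hL1
  have hu0 : 0 ≤ u := inv_nonneg.mpr (Nat.cast_nonneg _)
  -- the exponents of the lift
  set A : PBond P (t + 1) → EuclideanSpace ℝ (Fin 3) := fun e => u • logVec (su2Quat (X e)) with hA
  set a : PBond P t → EuclideanSpace ℝ (Fin 3) := fun b => ∑ e, w b e • A e with ha
  have hVa : ∀ b, V b = expPoint (a b) := fun b => by rw [hV]
  have hAσ : ∀ e, ‖logVec (su2Quat (X e))‖ ≤ σ → ‖A e‖ ≤ u * σ := fun e he => by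
    rw [hA]; dsimp only; rw [norm_smul, Real.norm_eq_abs, abs_of_nonneg hu0]
    exact mul_le_mul_of_nonneg_left he hu0
  have hAΔ : ∀ e R, ‖logVec (su2Quat (X e)) - R‖ ≤ Δ → ‖A e - u • R‖ ≤ u * Δ := fun e R he => by
    rw [hA]; dsimp only; rw [← smul_sub, norm_smul, Real.norm_eq_abs, abs_of_nonneg hu0]
    exact mul_le_mul_of_nonneg_left he hu0
  have ha1 : ‖a ⟨p.src, p.μ⟩‖ ≤ u * σ :=
    norm_hatSum_le_of_support ht w hw A _ fun e he => hAσ e (hσb e (Or.inl he))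
  have ha2 : ‖a ⟨p.src.shift p.μ, p.ν⟩‖ ≤ u * σ :=
    norm_hatSum_le_of_support ht w hw A _ fun e he => hAσ e (hσb e (Or.inr (Or.inl he)))
  have ha3 : ‖a ⟨p.src.shift p.ν, p.μ⟩‖ ≤ u * σ :=
    norm_hatSum_le_of_support ht w hw A _ fun e he => hAσ e (hσb e (Or.inr (Or.inr (Or.inl he))))
  have ha4 : ‖a ⟨p.src, p.ν⟩‖ ≤ u * σ :=
    norm_hatSum_le_of_support ht w hw A _ fun e he => hAσ e (hσb e (Or.inr (Or.inr (Or.inr he))))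
  have hupos : 0 < u := inv_pos.mpr (by exact_mod_cast P.L_pos)
  have hσ0 : 0 ≤ σ := le_of_mul_le_mul_left (by rw [mul_zero]; exact (norm_nonneg _).trans ha1) hupos
  have hτ : u * σ ≤ 1 / 4 := (mul_le_of_le_one_left hσ0 hu1).trans hσ4
  -- `Δ ≥ 0`: the support of a hat weight is non-empty
  obtain ⟨e₀, -, he₀⟩ := Finset.exists_ne_zero_of_sum_ne_zero (by rw [sum_hatW_eq_one ht w hw ⟨p.src, p.μ⟩]; exact one_ne_zero)
  have hΔ0 : 0 ≤ Δ := (norm_nonneg _).trans (hΔμ e₀ he₀)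
  -- (1) the fine plaquette to second order
  have h1 : dist1 (GaugeField.plaqHol V p)
      ≤ ‖imQuat (a ⟨p.src, p.μ⟩ + a ⟨p.src.shift p.μ, p.ν⟩ - a ⟨p.src.shift p.ν, p.μ⟩ - a ⟨p.src, p.ν⟩)
          + (imQuat (a ⟨p.src, p.μ⟩) * imQuat (a ⟨p.src, p.ν⟩) - imQuat (a ⟨p.src, p.ν⟩) * imQuat (a ⟨p.src, p.μ⟩))‖
        + ‖a ⟨p.src, p.μ⟩ + a ⟨p.src.shift p.μ, p.ν⟩ - a ⟨p.src.shift p.ν, p.μ⟩ - a ⟨p.src, p.ν⟩‖ ^ 2 / 2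
        + 3 * (u * σ) * (‖a ⟨p.src.shift p.ν, p.μ⟩ - a ⟨p.src, p.μ⟩‖ + ‖a ⟨p.src.shift p.μ, p.ν⟩ - a ⟨p.src, p.ν⟩‖)
        + ‖a ⟨p.src.shift p.ν, p.μ⟩ - a ⟨p.src, p.μ⟩‖ * ‖a ⟨p.src.shift p.μ, p.ν⟩ - a ⟨p.src, p.ν⟩‖ + 35 / 2 * (u * σ) ^ 3 := by
    unfold GaugeField.plaqHol
    rw [hVa, hVa, hVa, hVa]
    exact dist1_plaq4_le_comm ha1 ha2 ha3 ha4 hτ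
  -- (2) the fine linearised curl: `L⁻¹ ×` the column's worst, itself `L⁻¹ (F + 12σ²)`
  have h2 : ‖a ⟨p.src, p.μ⟩ + a ⟨p.src.shift p.μ, p.ν⟩ - a ⟨p.src.shift p.ν, p.μ⟩ - a ⟨p.src, p.ν⟩‖ ≤ u * (u * (F + 12 * σ ^ 2)) := by
    refine norm_lincurl_hat_le ht w hw A a (fun _ => rfl) p fun y hy => ?_
    obtain ⟨g1, g2, g3, g4, gF, -, -, -, -⟩ := hσy y hy
    have h3 := norm_lincurl_le_dist1_add g1 g2 g3 g4 hσ4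
    rw [expPoint_logVec, expPoint_logVec, expPoint_logVec, expPoint_logVec] at h3
    rw [hA]; dsimp only
    rw [← smul_add, ← smul_sub, ← smul_sub, norm_smul, Real.norm_eq_abs, abs_of_nonneg hu0]
    refine mul_le_mul_of_nonneg_left (h3.trans ?_) hu0
    have : dist1 (X ⟨y, p.μ⟩ * X ⟨y.shift p.μ, p.ν⟩ * (X ⟨y.shift p.ν, p.μ⟩)⁻¹ * (X ⟨y, p.ν⟩)⁻¹) ≤ F := gF
    linarith
  -- (3) the two fine parallel variations: `L⁻² Δ`
  have h3μ : ‖a ⟨p.src.shift p.ν, p.μ⟩ - a ⟨p.src, p.μ⟩‖ ≤ u * (u * Δ) := by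
    rw [norm_sub_rev]
    refine norm_sub_shift_hat_le ht w hw A a (fun _ => rfl) p.src p.hμν.ne' fun y hy => ?_
    obtain ⟨-, -, -, -, -, -, -, gv, -⟩ := hσy y hy
    rw [norm_sub_rev]
    exact hAΔ _ _ gv
  have h3ν : ‖a ⟨p.src.shift p.μ, p.ν⟩ - a ⟨p.src, p.ν⟩‖ ≤ u * (u * Δ) := by
    rw [norm_sub_rev]
    refine norm_sub_shift_hat_le ht w hw A a (fun _ => rfl) p.src p.hμν.ne fun y hy => ?_
    rw [colW_swap p.src p.μ p.ν y] at hy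
    obtain ⟨-, -, -, -, -, -, -, -, gv⟩ := hσy y hy
    rw [norm_sub_rev]
    exact hAΔ _ _ gv
  -- (4a) the fine commutator vs `L⁻² [ιRμ, ιRν]`
  have eC : imQuat (u • Rμ) * imQuat (u • Rν) - imQuat (u • Rν) * imQuat (u • Rμ)
      = u ^ 2 • (imQuat Rμ * imQuat Rν - imQuat Rν * imQuat Rμ) := by
    rw [map_smul, map_smul, smul_mul_smul_comm, smul_mul_smul_comm, ← smul_sub, sq]
  have h4a : ‖(imQuat (a ⟨p.src, p.μ⟩) * imQuat (a ⟨p.src, p.ν⟩) - imQuat (a ⟨p.src, p.ν⟩) * imQuat (a ⟨p.src, p.μ⟩))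
      - u ^ 2 • (imQuat Rμ * imQuat Rν - imQuat Rν * imQuat Rμ)‖ ≤ 4 * (u * σ) * (u * Δ) := by
    rw [← eC]
    refine norm_comm_sub_comm_ref_le _ _ _ _ ?_ ?_ ha4 ?_
    · exact norm_hatSum_sub_le_of_support ht w hw A ⟨p.src, p.μ⟩ (u • Rμ) fun e he => hAΔ e Rμ (hΔμ e he)
    · exact norm_hatSum_sub_le_of_support ht w hw A ⟨p.src, p.ν⟩ (u • Rν) fun e he => hAΔ e Rν (hΔν e he)
    · rw [norm_smul, Real.norm_eq_abs, abs_of_nonneg hu0]; exact mul_le_mul_of_nonneg_left hRμ hu0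
  -- (4b) the fine linearised curl + `L⁻² [ιRμ, ιRν]` = `L⁻² ×` the column average of (coarse curl + reference commutator)
  have hℓA : ∀ y : Site P (t + 1), A ⟨y, p.μ⟩ + A ⟨y.shift p.μ, p.ν⟩ - A ⟨y.shift p.ν, p.μ⟩ - A ⟨y, p.ν⟩
      = u • (logVec (su2Quat (X ⟨y, p.μ⟩)) + logVec (su2Quat (X ⟨y.shift p.μ, p.ν⟩)) - logVec (su2Quat (X ⟨y.shift p.ν, p.μ⟩))
          - logVec (su2Quat (X ⟨y, p.ν⟩))) := fun y => by
    rw [hA]; dsimp only; rw [← smul_add, ← smul_sub, ← smul_sub]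
  have key : imQuat (a ⟨p.src, p.μ⟩ + a ⟨p.src.shift p.μ, p.ν⟩ - a ⟨p.src.shift p.ν, p.μ⟩ - a ⟨p.src, p.ν⟩)
      = u ^ 2 • ∑ y : Site P (t + 1), ((if (p.src p.μ - emb y p.μ).val < P.L then (1 : ℝ) else 0) *
          (∏ κ ∈ (Finset.univ.erase p.μ).erase p.ν, max 0 (1 - ((rel (emb y) p.src κ).natAbs : ℝ) / P.L)) *
          (if (p.src p.ν - emb y p.ν).val < P.L then (1 : ℝ) else 0)) •
          imQuat (logVec (su2Quat (X ⟨y, p.μ⟩)) + logVec (su2Quat (X ⟨y.shift p.μ, p.ν⟩)) - logVec (su2Quat (X ⟨y.shift p.ν, p.μ⟩))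
            - logVec (su2Quat (X ⟨y, p.ν⟩))) := by
    rw [lincurl_hat_eq ht w hw A a (fun _ => rfl) p, map_smul, map_sum, ← hu, sq, mul_smul]
    congr 1
    rw [Finset.smul_sum]
    refine Finset.sum_congr rfl fun y _ => ?_
    rw [map_smul, hℓA y, map_smul]
    exact smul_comm _ _ _
  have hsum := sum_colW_eq_one ht p.src p.hμν.ne
  have h4b : ‖imQuat (a ⟨p.src, p.μ⟩ + a ⟨p.src.shift p.μ, p.ν⟩ - a ⟨p.src.shift p.ν, p.μ⟩ - a ⟨p.src, p.ν⟩)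
      + u ^ 2 • (imQuat Rμ * imQuat Rν - imQuat Rν * imQuat Rμ)‖
      ≤ u ^ 2 * (F + (F + 12 * σ ^ 2) ^ 2 / 2 + 10 * σ * Δ + Δ ^ 2 + 35 / 2 * σ ^ 3) := by
    rw [key, ← smul_add, norm_smul, Real.norm_eq_abs, abs_of_nonneg (sq_nonneg u)]
    refine mul_le_mul_of_nonneg_left ?_ (sq_nonneg u)
    -- `Σ W • Z + C = Σ W • (Z + C)` since `Σ W = 1`
    rw [show (imQuat Rμ * imQuat Rν - imQuat Rν * imQuat Rμ)
        = ∑ y : Site P (t + 1), ((if (p.src p.μ - emb y p.μ).val < P.L then (1 : ℝ) else 0) *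
          (∏ κ ∈ (Finset.univ.erase p.μ).erase p.ν, max 0 (1 - ((rel (emb y) p.src κ).natAbs : ℝ) / P.L)) *
          (if (p.src p.ν - emb y p.ν).val < P.L then (1 : ℝ) else 0)) • (imQuat Rμ * imQuat Rν - imQuat Rν * imQuat Rμ) by
        rw [← Finset.sum_smul, hsum, one_smul], ← Finset.sum_add_distrib]
    simp_rw [← smul_add]
    refine norm_sum_colW_smul_le ht p.src p.hμν.ne _ fun y hy => ?_
    obtain ⟨g1, g2, g3, g4, gF, gd1, gd4, gv3, gv2⟩ := hσy y hy
    exact norm_imQuat_lincurl_add_comm_ref_le _ _ _ _ Rμ Rν g1 g2 g3 g4 hσ4 hRμ gF gd1 gd4 gv3 gv2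
  -- (4) the second-order cancellation
  have h4 : ‖imQuat (a ⟨p.src, p.μ⟩ + a ⟨p.src.shift p.μ, p.ν⟩ - a ⟨p.src.shift p.ν, p.μ⟩ - a ⟨p.src, p.ν⟩)
          + (imQuat (a ⟨p.src, p.μ⟩) * imQuat (a ⟨p.src, p.ν⟩) - imQuat (a ⟨p.src, p.ν⟩) * imQuat (a ⟨p.src, p.μ⟩))‖
      ≤ u ^ 2 * (F + (F + 12 * σ ^ 2) ^ 2 / 2 + 10 * σ * Δ + Δ ^ 2 + 35 / 2 * σ ^ 3) + 4 * (u * σ) * (u * Δ) := by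
    rw [show imQuat (a ⟨p.src, p.μ⟩ + a ⟨p.src.shift p.μ, p.ν⟩ - a ⟨p.src.shift p.ν, p.μ⟩ - a ⟨p.src, p.ν⟩)
          + (imQuat (a ⟨p.src, p.μ⟩) * imQuat (a ⟨p.src, p.ν⟩) - imQuat (a ⟨p.src, p.ν⟩) * imQuat (a ⟨p.src, p.μ⟩))
        = (imQuat (a ⟨p.src, p.μ⟩ + a ⟨p.src.shift p.μ, p.ν⟩ - a ⟨p.src.shift p.ν, p.μ⟩ - a ⟨p.src, p.ν⟩)
            + u ^ 2 • (imQuat Rμ * imQuat Rν - imQuat Rν * imQuat Rμ))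
          + ((imQuat (a ⟨p.src, p.μ⟩) * imQuat (a ⟨p.src, p.ν⟩) - imQuat (a ⟨p.src, p.ν⟩) * imQuat (a ⟨p.src, p.μ⟩))
            - u ^ 2 • (imQuat Rμ * imQuat Rν - imQuat Rν * imQuat Rμ)) by abel]
    exact norm_add_le_of_le h4b h4a
  -- (5) bookkeeping: every junk term is `u²·(…)` with `u ≤ 1`
  have hX0 : 0 ≤ F + 12 * σ ^ 2 := by
    have : 0 ≤ F := by
      obtain ⟨y₀, -, hy₀⟩ := Finset.exists_ne_zero_of_sum_ne_zero (by rw [hsum]; exact one_ne_zero)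
      obtain ⟨-, -, -, -, gF, -⟩ := hσy y₀ hy₀
      exact (GaugeGroup.dist1_nonneg _).trans gF
    positivity
  have hℓsq : ‖a ⟨p.src, p.μ⟩ + a ⟨p.src.shift p.μ, p.ν⟩ - a ⟨p.src.shift p.ν, p.μ⟩ - a ⟨p.src, p.ν⟩‖ ^ 2 / 2
      ≤ u ^ 2 * ((F + 12 * σ ^ 2) ^ 2 / 2) := by
    have h := pow_le_pow_left₀ (norm_nonneg _) h2 2
    have hu4 : (u * (u * (F + 12 * σ ^ 2))) ^ 2 ≤ u ^ 2 * (F + 12 * σ ^ 2) ^ 2 := by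
      rw [show (u * (u * (F + 12 * σ ^ 2))) ^ 2 = (u ^ 2) * (u ^ 2 * (F + 12 * σ ^ 2) ^ 2) by ring]
      exact mul_le_of_le_one_left (by positivity) (pow_le_one₀ hu0 hu1)
    linarith
  have hvar : 3 * (u * σ) * (‖a ⟨p.src.shift p.ν, p.μ⟩ - a ⟨p.src, p.μ⟩‖ + ‖a ⟨p.src.shift p.μ, p.ν⟩ - a ⟨p.src, p.ν⟩‖)
      ≤ u ^ 2 * (6 * σ * Δ) := by
    have h := mul_le_mul_of_nonneg_left (add_le_add h3μ h3ν) (show 0 ≤ 3 * (u * σ) by positivity)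
    have h' : 3 * (u * σ) * (u * (u * Δ) + u * (u * Δ)) = u * (u ^ 2 * (6 * σ * Δ)) := by ring
    rw [h'] at h
    exact h.trans (mul_le_of_le_one_left (by positivity) hu1)
  have hvar2 : ‖a ⟨p.src.shift p.ν, p.μ⟩ - a ⟨p.src, p.μ⟩‖ * ‖a ⟨p.src.shift p.μ, p.ν⟩ - a ⟨p.src, p.ν⟩‖ ≤ u ^ 2 * Δ ^ 2 := by
    have h := mul_le_mul h3μ h3ν (norm_nonneg _) (by positivity)
    have h' : u * (u * Δ) * (u * (u * Δ)) = u ^ 2 * (u ^ 2 * Δ ^ 2) := by ring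
    rw [h'] at h
    exact h.trans (mul_le_of_le_one_left (by positivity) (pow_le_one₀ hu0 hu1))
  have hcube : 35 / 2 * (u * σ) ^ 3 ≤ u ^ 2 * (35 / 2 * σ ^ 3) := by
    rw [show 35 / 2 * (u * σ) ^ 3 = u * (u ^ 2 * (35 / 2 * σ ^ 3)) by ring]
    exact mul_le_of_le_one_left (by positivity) hu1
  have hcomm : 4 * (u * σ) * (u * Δ) = u ^ 2 * (4 * σ * Δ) := by ring
  rw [hcomm] at h4
  have htot := h1.trans (add_le_add (add_le_add (add_le_add (add_le_add h4 hℓsq) hvar) hvar2) hcube)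
  refine htot.trans (le_of_eq ?_)
  ring

end Summit.QuantumFields.YangMills.Theorems.FluctuationComparisonRegPrIntLS2BetaWhitneyHatLiftCurvatureSecondOrder
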